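import Summits.QuantumFields.BalabanUV.Beta.FP.LegPairingBounds
import Summits.QuantumFields.BalabanUV.Beta.FP.LegsShellBound

/-!
# `BalabanUV.Beta.FP.LegPairingRemainder` — THE GENERIC TAYLOR PAIRING OF LOCAL STENCILS AGAINST A GRADED LEG: `|bubble − finite table of smeared legs| ≤ K/(‖p−q‖∞+2)⁷`,
# and the `hlegs`-shape window bound it feeds (road «FP», LEGS generic track, module (R) part 2; [folklore], `ℤ⁴`)

HONEST DEPENDENCY (page 1, mandatory): continuum YM on T⁴ ⇐ BetaPertH ∧ nine spine estimates (0/9 proved); BetaPertH ⇐ (D1) ∧ (D4) ∧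
CAP+tail; G-an2-4 gates asym, D1 and NE2/3/4.  HONEST FRAMING (cell contract, verbatim): «discharging `BetaPertH` makes Bałaban's UV
stability UNCONDITIONAL — a real constructive-QFT result; it is NOT the continuum limit and NOT the Clay problem.»  THIS MODULE is elementary
[folklore] analysis on `ℤ⁴` over `FP/LegPairingBounds` + `FP/LegPairingTable` + `FP/StencilMoments`, joined BY NAME to asym1's `FP/LegsShellBound.hlegs_of_germWindow`;
it asserts nothing about Bałaban's objects, cites nothing, mints no `Prop` fact, 0 sorry; its two `def`s (`kap`, `remConst`) are explicit real constants.  The GRADED leg bounds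
(`|A(x,y)| ≤ C/(‖x−y‖∞+1)²`, `|∂³A(x,y)| ≤ C/(‖x−y‖∞+1)⁵`) are HYPOTHESES — for road FP's perfect propagator they are window ∕ tail rows of the owner's N7 PLAN,
not proved here.  NOT D1, NOT BetaPertH, NOT continuum, NOT Clay.

CONTENT.  §1 the remainder integrand `remTerm A V W p q` of `LegPairingTable` is bi-localised at `(p, q)` (rate `δ/2`) with constant `remConst/(‖p−q‖∞+2)⁷`
(`biLoc_remTerm_graded`: the four row bounds of `LegPairingBounds` §5, the two polynomial weights absorbed by `StencilMoments.pow_succ_mul_exp_le'`);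
§2 a bi-localised four-fold series is `≤ |F|²·C·Zl²` (`abs_dsum_le`); §3 THE PAIRING ESTIMATE `abs_bubble_sub_table_le`:
`|bubble A V W − Σ_{a c ι κ} sLeg ι κ A V p q a c · sLeg κ ι A W q p c a| ≤ |F|²·remConst·Zl(δ/2)²/(‖p−q‖∞+2)⁷`; §4 the junction: at a base point (`p = b`,
`q = b + w`) the bound reads `…/(‖w‖∞+2)⁷` (`abs_bubble_sub_table_le_basePoint`), a global septic bound IS the window germ `hgerm` of
`LegsShellBound.hlegs_of_germWindow` on every shell (`germWindow_of_pairing`), whence `hlegs_of_pairing : |psum Φ R₀ − Σ_{annulus 0 R₀} w_μ w_ν T w| ≤ 160·D` for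
EVERY `R₀` — the `hlegs` binder shape of `RepAssembly.hrep_of_basePoint_nUniform`; the consumer instantiates `T` with the finite leg table `Σ_i cc₀ i·F′ i w·G′ i w`.
Unit `b2b-balaban-beta-d1-formalise-leaf-02` (gen 5).
-/

noncomputable section

namespace Summit.QuantumFields.BalabanUV.Beta.FP.LegPairingRemainder

open Finset fwdDiff
open scoped BigOperators
open Literature.MathematicalPhysics.QuantumFieldTheory.Balaban1983to89
open Literature.MathematicalPhysics.QuantumFieldTheory.Balaban1983to89.Beta
open B12Sec2to5 (l1 l1_nonneg)
open ExpKernelCalculus (Site MKer BiLoc comp tr bubble Zl Zl_pos summable_exp_shift' tsum_exp_shift')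
open KernelWard (Bdd)
open Literature.Probability.LatticeModels (annulus)
open DyadicShell (Pt supNorm supNorm_eq_of_mem_sphere toReal)
open GradedBubbles (supNorm_neg)
open WindowIdentification (psum)
open Summit.QuantumFields.BalabanUV.Beta.FP.LatticeTaylorIndex (Idx mono dOp abs_mono_le)
open Summit.QuantumFields.BalabanUV.Beta.FP.StencilMoments (pow_succ_mul_exp_le' summable_row abs_tsum_row_le)
open Summit.QuantumFields.BalabanUV.Beta.FP.LegPairing (dKer remKer sLeg)
open Summit.QuantumFields.BalabanUV.Beta.FP.LegPairingTable (remTerm bubble_sub_table_eq)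
open Summit.QuantumFields.BalabanUV.Beta.FP.LegPairingBounds (supNorm_le_l1 abs_rowP_le abs_rowR_le abs_rowAW_le abs_rowR'_le)

variable {F : Type*} [Fintype F]

/-! ## §1 The remainder integrand is bi-localised with constant `remConst/(‖p−q‖∞+2)⁷` -/

/-- [folklore] The weight-absorption constant `κ_k(δ) = k!·e^{δ/2}·(2/δ)^k` of `StencilMoments.pow_succ_mul_exp_le'`. -/
def kap (k : ℕ) (δ : ℝ) : ℝ := (k.factorial : ℝ) * Real.exp (δ / 2) * (2 / δ) ^ k

/-- [folklore] `0 ≤ κ_k(δ)` for `δ > 0`. -/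
theorem kap_nonneg (k : ℕ) {δ : ℝ} (hδ : 0 < δ) : 0 ≤ kap k δ := by unfold kap; positivity

/-- [folklore] THE REMAINDER CONSTANT of the Taylor pairing (fibre size `n`, graded-leg constant `C`, stencil constants `C_V, C_W`, rate `δ`):
`|Idx 4|·(n·144C·C_V·κ₂Zl)·(n·3200C·C_W·κ₅Zl)·κ₂κ₈ + (n·3200C·C_V·κ₅Zl)·(n·4C·C_W·κ₂Zl)·κ₈κ₂` (`Zl = Zl 4 (δ/2)`). -/
def remConst (n : ℕ) (C Cv Cw δ : ℝ) : ℝ :=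
  (Fintype.card (Idx 4) : ℝ) * ((n : ℝ) * (144 * C) * Cv * (kap 2 δ * Zl 4 (δ / 2))) * ((n : ℝ) * (3200 * C) * Cw * (kap 5 δ * Zl 4 (δ / 2)))
      * (kap 2 δ * kap 8 δ)
    + ((n : ℝ) * (3200 * C) * Cv * (kap 5 δ * Zl 4 (δ / 2))) * ((n : ℝ) * (4 * C) * Cw * (kap 2 δ * Zl 4 (δ / 2))) * (kap 8 δ * kap 2 δ)

/-- [folklore] `0 ≤ remConst` for nonnegative data. -/
theorem remConst_nonneg (n : ℕ) {C Cv Cw δ : ℝ} (hC : 0 ≤ C) (hCv : 0 ≤ Cv) (hCw : 0 ≤ Cw) (hδ : 0 < δ) : 0 ≤ remConst n C Cv Cw δ := by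
  have h2 := kap_nonneg 2 hδ; have h5 := kap_nonneg 5 hδ; have h8 := kap_nonneg 8 hδ
  have hZ : (0 : ℝ) ≤ Zl 4 (δ / 2) := (Zl_pos (show (0 : ℝ) < δ / 2 by positivity)).le
  unfold remConst; positivity

section Pointwise

variable {A V W : MKer 4 F} {C Cv Cw δ : ℝ} {p q : Pt}

/-- [folklore] TERM 1 of the remainder integrand (Taylor polynomial of the first row × remainder of the second), raw weights:
`≤ |Idx 4|·K₁K₂/(‖p−q‖∞+2)⁷ · ((|x−p|₁+1)² e^{−δ|x−p|₁}) · ((|z−q|₁+1)⁸ e^{−δ|z−q|₁})`. -/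
theorem abs_polyTerm_le (hC : 0 ≤ C) (hδ : 0 < δ) (h0 : ∀ (x y : Pt) (a b : F), |A x y a b| ≤ C / ((supNorm (x - y) : ℝ) + 1) ^ 2)
    (h3 : ∀ (i j k : Fin 4) (x y : Pt) (a b : F),
      |Δ_[(Pi.single i 1 : Pt)] (Δ_[(Pi.single j 1 : Pt)] (Δ_[(Pi.single k 1 : Pt)] fun x' => A x' y a b)) x| ≤ C / ((supNorm (x - y) : ℝ) + 1) ^ 5)
    (hV : BiLoc V q q Cv δ) (hW : BiLoc W p p Cw δ) (x z : Pt) (a c : F) :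
    |(∑ ι : Idx 4, mono ι (x - p) * comp (dKer ι A) V p z a c) * comp (remKer q A) W z x c a|
      ≤ (Fintype.card (Idx 4) : ℝ) * ((Fintype.card F : ℝ) * (144 * C) * Cv * (kap 2 δ * Zl 4 (δ / 2)))
          * ((Fintype.card F : ℝ) * (3200 * C) * Cw * (kap 5 δ * Zl 4 (δ / 2))) / ((supNorm (p - q) : ℝ) + 2) ^ 7
        * (((l1 (x - p) + 1) ^ 2 * Real.exp (-δ * l1 (x - p))) * ((l1 (z - q) + 1) ^ 8 * Real.exp (-δ * l1 (z - q)))) := by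
  have hCv : 0 ≤ Cv := hV.nonneg a
  have hCw : 0 ≤ Cw := hW.nonneg a
  have hZ0 : (0 : ℝ) ≤ Zl 4 (δ / 2) := (Zl_pos (show (0 : ℝ) < δ / 2 by positivity)).le
  have hk2 : 0 ≤ kap 2 δ := kap_nonneg 2 hδ
  have hL2 : (0 : ℝ) < (supNorm (p - q) : ℝ) + 2 := by positivity
  have hP0 : 0 ≤ (Fintype.card F : ℝ) * (144 * C / ((supNorm (p - q) : ℝ) + 2) ^ 2) * Cv * (kap 2 δ * Zl 4 (δ / 2)) * Real.exp (-δ * l1 (z - q)) := by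
    positivity
  have hvz : (supNorm (z - q) : ℝ) + 1 ≤ l1 (z - q) + 1 := by linarith [supNorm_le_l1 (z - q)]
  -- the polynomial part
  have hT : |∑ ι : Idx 4, mono ι (x - p) * comp (dKer ι A) V p z a c|
      ≤ (Fintype.card (Idx 4) : ℝ) * ((l1 (x - p) + 1) ^ 2
          * ((Fintype.card F : ℝ) * (144 * C / ((supNorm (p - q) : ℝ) + 2) ^ 2) * Cv * (kap 2 δ * Zl 4 (δ / 2)) * Real.exp (-δ * l1 (z - q)))) := by
    calc |∑ ι : Idx 4, mono ι (x - p) * comp (dKer ι A) V p z a c| ≤ ∑ ι : Idx 4, |mono ι (x - p) * comp (dKer ι A) V p z a c| :=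
          abs_sum_le_sum_abs _ _
      _ ≤ ∑ _ι : Idx 4, (l1 (x - p) + 1) ^ 2
            * ((Fintype.card F : ℝ) * (144 * C / ((supNorm (p - q) : ℝ) + 2) ^ 2) * Cv * (kap 2 δ * Zl 4 (δ / 2)) * Real.exp (-δ * l1 (z - q))) :=
          sum_le_sum fun ι _ => by
            rw [abs_mul]; exact mul_le_mul (abs_mono_le ι (x - p)) (abs_rowP_le hC hδ h0 hV ι z a c) (abs_nonneg _) (by positivity)
      _ = _ := by rw [sum_const, card_univ, nsmul_eq_mul]
  -- the second remainder, weight converted to `|z−q|₁`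
  have hR' : |comp (remKer q A) W z x c a| ≤ (Fintype.card F : ℝ) * (3200 * C * (l1 (z - q) + 1) ^ 8 / ((supNorm (p - q) : ℝ) + 2) ^ 5) * Cw
      * (kap 5 δ * Zl 4 (δ / 2)) * Real.exp (-δ * l1 (x - p)) := by
    refine (abs_rowR'_le hC hδ h3 hW z x c a).trans ?_
    have h8 : ((supNorm (z - q) : ℝ) + 1) ^ 8 ≤ (l1 (z - q) + 1) ^ 8 := pow_le_pow_left₀ (by positivity) hvz 8
    have : 3200 * C * ((supNorm (z - q) : ℝ) + 1) ^ 8 / ((supNorm (p - q) : ℝ) + 2) ^ 5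
        ≤ 3200 * C * (l1 (z - q) + 1) ^ 8 / ((supNorm (p - q) : ℝ) + 2) ^ 5 := by gcongr
    unfold kap; gcongr
  rw [abs_mul]
  refine (mul_le_mul hT hR' (abs_nonneg _) ((abs_nonneg _).trans hT)).trans (le_of_eq ?_)
  have h7 : ((((supNorm (p - q) : ℝ) + 2) ^ 7)⁻¹ : ℝ) = (((supNorm (p - q) : ℝ) + 2) ^ 2)⁻¹ * (((supNorm (p - q) : ℝ) + 2) ^ 5)⁻¹ := by
    rw [← mul_inv, ← pow_add]
  simp only [div_eq_mul_inv, h7]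
  ring

/-- [folklore] TERM 2 of the remainder integrand (remainder of the first row × the full second row), raw weights:
`≤ K₃K₄/(‖p−q‖∞+2)⁷ · ((|x−p|₁+1)⁸ e^{−δ|x−p|₁}) · ((|z−q|₁+1)² e^{−δ|z−q|₁})`. -/
theorem abs_remProd_le (hC : 0 ≤ C) (hδ : 0 < δ) (h0 : ∀ (x y : Pt) (a b : F), |A x y a b| ≤ C / ((supNorm (x - y) : ℝ) + 1) ^ 2)
    (h3 : ∀ (i j k : Fin 4) (x y : Pt) (a b : F),
      |Δ_[(Pi.single i 1 : Pt)] (Δ_[(Pi.single j 1 : Pt)] (Δ_[(Pi.single k 1 : Pt)] fun x' => A x' y a b)) x| ≤ C / ((supNorm (x - y) : ℝ) + 1) ^ 5)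
    (hV : BiLoc V q q Cv δ) (hW : BiLoc W p p Cw δ) (x z : Pt) (a c : F) :
    |comp (remKer p A) V x z a c * comp A W z x c a|
      ≤ ((Fintype.card F : ℝ) * (3200 * C) * Cv * (kap 5 δ * Zl 4 (δ / 2))) * ((Fintype.card F : ℝ) * (4 * C) * Cw * (kap 2 δ * Zl 4 (δ / 2)))
          / ((supNorm (p - q) : ℝ) + 2) ^ 7
        * (((l1 (x - p) + 1) ^ 8 * Real.exp (-δ * l1 (x - p))) * ((l1 (z - q) + 1) ^ 2 * Real.exp (-δ * l1 (z - q)))) := by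
  have hCv : 0 ≤ Cv := hV.nonneg a
  have hCw : 0 ≤ Cw := hW.nonneg a
  have hZ0 : (0 : ℝ) ≤ Zl 4 (δ / 2) := (Zl_pos (show (0 : ℝ) < δ / 2 by positivity)).le
  have hL2 : (0 : ℝ) < (supNorm (p - q) : ℝ) + 2 := by positivity
  have hvz : (supNorm (z - q) : ℝ) + 1 ≤ l1 (z - q) + 1 := by linarith [supNorm_le_l1 (z - q)]
  have hvx : (supNorm (x - p) : ℝ) + 1 ≤ l1 (x - p) + 1 := by linarith [supNorm_le_l1 (x - p)]
  have hR : |comp (remKer p A) V x z a c| ≤ (Fintype.card F : ℝ) * (3200 * C * (l1 (x - p) + 1) ^ 8 / ((supNorm (p - q) : ℝ) + 2) ^ 5) * Cv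
      * (kap 5 δ * Zl 4 (δ / 2)) * Real.exp (-δ * l1 (z - q)) := by
    refine (abs_rowR_le hC hδ h3 hV x z a c).trans ?_
    have h8 : ((supNorm (x - p) : ℝ) + 1) ^ 8 ≤ (l1 (x - p) + 1) ^ 8 := pow_le_pow_left₀ (by positivity) hvx 8
    have : 3200 * C * ((supNorm (x - p) : ℝ) + 1) ^ 8 / ((supNorm (p - q) : ℝ) + 2) ^ 5
        ≤ 3200 * C * (l1 (x - p) + 1) ^ 8 / ((supNorm (p - q) : ℝ) + 2) ^ 5 := by gcongr
    unfold kap; gcongr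
  have hAW : |comp A W z x c a| ≤ (Fintype.card F : ℝ) * (4 * C * (l1 (z - q) + 1) ^ 2 / ((supNorm (p - q) : ℝ) + 2) ^ 2) * Cw
      * (kap 2 δ * Zl 4 (δ / 2)) * Real.exp (-δ * l1 (x - p)) := by
    refine (abs_rowAW_le (q := q) hC hδ h0 hW z x c a).trans ?_
    have h2 : ((supNorm (z - q) : ℝ) + 1) ^ 2 ≤ (l1 (z - q) + 1) ^ 2 := pow_le_pow_left₀ (by positivity) hvz 2
    have : 4 * C * ((supNorm (z - q) : ℝ) + 1) ^ 2 / ((supNorm (p - q) : ℝ) + 2) ^ 2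
        ≤ 4 * C * (l1 (z - q) + 1) ^ 2 / ((supNorm (p - q) : ℝ) + 2) ^ 2 := by gcongr
    unfold kap; gcongr
  rw [abs_mul]
  refine (mul_le_mul hR hAW (abs_nonneg _) ((abs_nonneg _).trans hR)).trans (le_of_eq ?_)
  have h7 : ((((supNorm (p - q) : ℝ) + 2) ^ 7)⁻¹ : ℝ) = (((supNorm (p - q) : ℝ) + 2) ^ 2)⁻¹ * (((supNorm (p - q) : ℝ) + 2) ^ 5)⁻¹ := by
    rw [← mul_inv, ← pow_add]
  simp only [div_eq_mul_inv, h7]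
  ring

/-- **THE REMAINDER INTEGRAND IS BI-LOCALISED AT `(p, q)` WITH CONSTANT `remConst/(‖p−q‖∞+2)⁷`** (rate `δ/2`), from the graded bounds of order 0 and 3 on
the leg `A`, `V` bi-localised at `(q,q)` and `W` at `(p,p)`. [folklore] -/
theorem biLoc_remTerm_graded (hC : 0 ≤ C) (hδ : 0 < δ) (h0 : ∀ (x y : Pt) (a b : F), |A x y a b| ≤ C / ((supNorm (x - y) : ℝ) + 1) ^ 2)
    (h3 : ∀ (i j k : Fin 4) (x y : Pt) (a b : F),
      |Δ_[(Pi.single i 1 : Pt)] (Δ_[(Pi.single j 1 : Pt)] (Δ_[(Pi.single k 1 : Pt)] fun x' => A x' y a b)) x| ≤ C / ((supNorm (x - y) : ℝ) + 1) ^ 5)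
    (hV : BiLoc V q q Cv δ) (hW : BiLoc W p p Cw δ) :
    BiLoc (remTerm A V W p q) p q (remConst (Fintype.card F) C Cv Cw δ / ((supNorm (p - q) : ℝ) + 2) ^ 7) (δ / 2) := by
  intro x z a c
  have hCv : 0 ≤ Cv := hV.nonneg a
  have hCw : 0 ≤ Cw := hW.nonneg a
  have hZ0 : (0 : ℝ) ≤ Zl 4 (δ / 2) := (Zl_pos (show (0 : ℝ) < δ / 2 by positivity)).le
  have hk2 : 0 ≤ kap 2 δ := kap_nonneg 2 hδ
  have hk5 : 0 ≤ kap 5 δ := kap_nonneg 5 hδ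
  have hk8 : 0 ≤ kap 8 δ := kap_nonneg 8 hδ
  have hL2 : (0 : ℝ) < (supNorm (p - q) : ℝ) + 2 := by positivity
  have n1 : 0 ≤ (Fintype.card (Idx 4) : ℝ) * ((Fintype.card F : ℝ) * (144 * C) * Cv * (kap 2 δ * Zl 4 (δ / 2)))
      * ((Fintype.card F : ℝ) * (3200 * C) * Cw * (kap 5 δ * Zl 4 (δ / 2))) / ((supNorm (p - q) : ℝ) + 2) ^ 7 := by positivity
  have n2 : 0 ≤ ((Fintype.card F : ℝ) * (3200 * C) * Cv * (kap 5 δ * Zl 4 (δ / 2))) * ((Fintype.card F : ℝ) * (4 * C) * Cw * (kap 2 δ * Zl 4 (δ / 2)))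
      / ((supNorm (p - q) : ℝ) + 2) ^ 7 := by positivity
  -- weights absorbed: `(l+1)^k e^{−δl} ≤ κ_k e^{−(δ/2)l}`
  have wk : ∀ (k : ℕ) (l : ℝ), 0 ≤ l → (l + 1) ^ k * Real.exp (-δ * l) ≤ kap k δ * Real.exp (-(δ / 2) * l) :=
    fun k l hl => pow_succ_mul_exp_le' k hδ hl
  have hx0 : 0 ≤ l1 (x - p) := l1_nonneg _
  have hz0 : 0 ≤ l1 (z - q) := l1_nonneg _
  have wnn : ∀ (k : ℕ) (l : ℝ), 0 ≤ l → 0 ≤ (l + 1) ^ k * Real.exp (-δ * l) := fun k l hl => by positivity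
  have knn : ∀ (k : ℕ) (l : ℝ), 0 ≤ kap k δ * Real.exp (-(δ / 2) * l) := fun k l => mul_nonneg (kap_nonneg k hδ) (Real.exp_pos _).le
  have t1 := (abs_polyTerm_le hC hδ h0 h3 hV hW x z a c).trans
    (mul_le_mul_of_nonneg_left (mul_le_mul (wk 2 _ hx0) (wk 8 _ hz0) (wnn 8 _ hz0) (knn 2 _)) n1)
  have t2 := (abs_remProd_le hC hδ h0 h3 hV hW x z a c).trans
    (mul_le_mul_of_nonneg_left (mul_le_mul (wk 8 _ hx0) (wk 2 _ hz0) (wnn 2 _ hz0) (knn 8 _)) n2)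
  have hexp : Real.exp (-(δ / 2) * (l1 (x - p) + l1 (z - q))) = Real.exp (-(δ / 2) * l1 (x - p)) * Real.exp (-(δ / 2) * l1 (z - q)) := by
    rw [← Real.exp_add]; ring_nf
  rw [hexp]
  unfold remTerm
  refine (abs_add_le _ _).trans ((add_le_add t1 t2).trans (le_of_eq ?_))
  unfold remConst
  ring

end Pointwise

/-! ## §2 A bi-localised four-fold series is bounded by `|F|²·C·Zl²` -/

/-- [folklore] **THE FOUR-FOLD SERIES OF A BI-LOCALISED KERNEL**: `|Σ'_x Σ_a Σ'_z Σ_c K x z a c| ≤ |F|²·C·Zl(δ)²`. -/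
theorem abs_dsum_le {K : MKer 4 F} {p q : Pt} {Cb δ : ℝ} (hK : BiLoc K p q Cb δ) (hδ : 0 < δ) :
    |∑' x, ∑ a, ∑' z, ∑ c, K x z a c| ≤ (Fintype.card F : ℝ) ^ 2 * Cb * Zl 4 δ ^ 2 := by
  classical
  set nF : ℝ := (Fintype.card F : ℝ) with hnF
  have hin : ∀ (x : Pt) (a : F), |∑' z, ∑ c, K x z a c| ≤ nF * (Cb * Zl 4 δ * Real.exp (-δ * l1 (x - p))) := by
    intro x a
    rw [Summable.tsum_finsetSum (fun c _ => summable_row hK hδ x a c)]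
    calc |∑ c, ∑' z, K x z a c| ≤ ∑ c, |∑' z, K x z a c| := abs_sum_le_sum_abs _ _
      _ ≤ ∑ _c : F, Cb * Zl 4 δ * Real.exp (-δ * l1 (x - p)) := sum_le_sum fun c _ => abs_tsum_row_le hK hδ x a c
      _ = _ := by rw [sum_const, card_univ, nsmul_eq_mul]
  have hout : ∀ x : Pt, |∑ a, ∑' z, ∑ c, K x z a c| ≤ (nF * nF * (Cb * Zl 4 δ)) * Real.exp (-δ * l1 (x - p)) := by
    intro x
    calc |∑ a, ∑' z, ∑ c, K x z a c| ≤ ∑ a, |∑' z, ∑ c, K x z a c| := abs_sum_le_sum_abs _ _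
      _ ≤ ∑ _a : F, nF * (Cb * Zl 4 δ * Real.exp (-δ * l1 (x - p))) := sum_le_sum fun a _ => hin x a
      _ = _ := by rw [sum_const, card_univ, nsmul_eq_mul]; ring
  have hs := (summable_exp_shift' hδ p).mul_left (nF * nF * (Cb * Zl 4 δ))
  have hsum : Summable fun x => ∑ a, ∑' z, ∑ c, K x z a c :=
    Summable.of_norm_bounded hs (fun x => by rw [Real.norm_eq_abs]; exact hout x)
  have h1 : |∑' x, ∑ a, ∑' z, ∑ c, K x z a c| ≤ ∑' x, |∑ a, ∑' z, ∑ c, K x z a c| := by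
    have := norm_tsum_le_tsum_norm hsum.norm
    simpa only [Real.norm_eq_abs] using this
  refine h1.trans ((hsum.abs.tsum_le_tsum hout hs).trans (le_of_eq ?_))
  rw [tsum_mul_left, tsum_exp_shift']; ring

/-! ## §3 The pairing estimate -/

section Main

variable {A V W : MKer 4 F} {C Cv Cw δ : ℝ} {p q : Pt}

omit [Fintype F] in
/-- [folklore] The order-zero graded bound implies the plain bound `Bdd A C`. -/
theorem bdd_of_graded (hC : 0 ≤ C) (h0 : ∀ (x y : Pt) (a b : F), |A x y a b| ≤ C / ((supNorm (x - y) : ℝ) + 1) ^ 2) : Bdd A C := by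
  intro x y a b
  refine (h0 x y a b).trans (div_le_self hC ?_)
  have : (0 : ℝ) ≤ (supNorm (x - y) : ℝ) := Nat.cast_nonneg _
  nlinarith

/-- **THE TAYLOR PAIRING ESTIMATE (LEGS, generic)**: for a leg `A` with graded bounds of order 0 and 3 (constant `C`, sup-norm powers 2 and 5), a stencil `V`
bi-localised at `(q,q)` and `W` at `(p,p)` (rate `δ > 0`),
`|bubble A V W − Σ_a Σ_c Σ_ι Σ_κ sLeg ι κ A V p q a c · sLeg κ ι A W q p c a| ≤ |F|²·remConst·Zl(δ/2)²/(‖p−q‖∞+2)⁷`: the bubble equals a FINITE bilinear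
table of smeared difference legs up to an error summable against `‖p−q‖∞²` over `ℤ⁴`. [folklore] -/
theorem abs_bubble_sub_table_le (hC : 0 ≤ C) (hδ : 0 < δ) (h0 : ∀ (x y : Pt) (a b : F), |A x y a b| ≤ C / ((supNorm (x - y) : ℝ) + 1) ^ 2)
    (h3 : ∀ (i j k : Fin 4) (x y : Pt) (a b : F),
      |Δ_[(Pi.single i 1 : Pt)] (Δ_[(Pi.single j 1 : Pt)] (Δ_[(Pi.single k 1 : Pt)] fun x' => A x' y a b)) x| ≤ C / ((supNorm (x - y) : ℝ) + 1) ^ 5)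
    (hV : BiLoc V q q Cv δ) (hW : BiLoc W p p Cw δ) :
    |bubble A V W - ∑ a : F, ∑ c : F, ∑ ι : Idx 4, ∑ κ : Idx 4, sLeg ι κ A V p q a c * sLeg κ ι A W q p c a|
      ≤ (Fintype.card F : ℝ) ^ 2 * remConst (Fintype.card F) C Cv Cw δ * Zl 4 (δ / 2) ^ 2 / ((supNorm (p - q) : ℝ) + 2) ^ 7 := by
  rw [bubble_sub_table_eq (bdd_of_graded hC h0) hV hW hδ]
  refine (abs_dsum_le (biLoc_remTerm_graded hC hδ h0 h3 hV hW) (half_pos hδ)).trans (le_of_eq ?_)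
  ring

end Main

/-! ## §4 Junction with `FP/LegsShellBound`: the pairing estimate IS the septic window germ -/

section Window

variable {A : MKer 4 F} {C Cv Cw δ : ℝ}

/-- **THE PAIRING ESTIMATE AT A BASE POINT** (`p := b`, `q := b + w`, so `‖p−q‖∞ = ‖w‖∞`): for stencils `V w` bi-localised at `(b+w, b+w)` and `W₀` at `(b, b)`,
`|bubble A (V w) W₀ − table(w)| ≤ |F|²·remConst·Zl(δ/2)²/(‖w‖∞+2)⁷` for EVERY `w`. [folklore] -/
theorem abs_bubble_sub_table_le_basePoint (hC : 0 ≤ C) (hδ : 0 < δ) (h0 : ∀ (x y : Pt) (a b : F), |A x y a b| ≤ C / ((supNorm (x - y) : ℝ) + 1) ^ 2)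
    (h3 : ∀ (i j k : Fin 4) (x y : Pt) (a b : F),
      |Δ_[(Pi.single i 1 : Pt)] (Δ_[(Pi.single j 1 : Pt)] (Δ_[(Pi.single k 1 : Pt)] fun x' => A x' y a b)) x| ≤ C / ((supNorm (x - y) : ℝ) + 1) ^ 5)
    {V : Pt → MKer 4 F} {W₀ : MKer 4 F} {b : Pt} (hV : ∀ w, BiLoc (V w) (b + w) (b + w) Cv δ) (hW : BiLoc W₀ b b Cw δ) (w : Pt) :
    |bubble A (V w) W₀ - ∑ a : F, ∑ c : F, ∑ ι : Idx 4, ∑ κ : Idx 4, sLeg ι κ A (V w) b (b + w) a c * sLeg κ ι A W₀ (b + w) b c a|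
      ≤ (Fintype.card F : ℝ) ^ 2 * remConst (Fintype.card F) C Cv Cw δ * Zl 4 (δ / 2) ^ 2 / ((supNorm w : ℝ) + 2) ^ 7 := by
  have h := abs_bubble_sub_table_le hC hδ h0 h3 (hV w) hW
  rwa [show b - (b + w) = -w by abel, supNorm_neg] at h

variable {Kk T : Pt → ℝ} {a D : ℝ} {μ ν : Fin 4}

/-- [folklore] On the shell `annulus 4 r (r+1)`: `D/(‖w‖∞+2)⁷ ≤ D/(r+1)⁷` (`0 ≤ D`). -/
theorem div_supNorm_add_two_pow_le (hD : 0 ≤ D) {r : ℕ} {w : Pt} (hw : w ∈ annulus 4 r (r + 1)) :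
    D / ((supNorm w : ℝ) + 2) ^ 7 ≤ D / ((r : ℝ) + 1) ^ 7 := by
  rw [supNorm_eq_of_mem_sphere hw]
  push_cast
  have hr : (0 : ℝ) < (r : ℝ) + 1 := by positivity
  exact div_le_div_of_nonneg_left hD (pow_pos hr 7) (pow_le_pow_left₀ hr.le (by linarith) 7)

/-- **A GLOBAL SEPTIC BOUND IS THE WINDOW GERM `hgerm` OF `LegsShellBound.hlegs_of_germWindow`** (on every window shell, for every `R₀`). [folklore] -/
theorem germWindow_of_pairing (hD : 0 ≤ D) (h : ∀ w : Pt, |a * Kk w - T w| ≤ D / ((supNorm w : ℝ) + 2) ^ 7) (R₀ : ℕ) :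
    ∀ r : ℕ, r + 1 ≤ R₀ → ∀ w ∈ annulus 4 r (r + 1), |a * Kk w - T w| ≤ D / ((r : ℝ) + 1) ^ 7 :=
  fun _ _ w hw => (h w).trans (div_supNorm_add_two_pow_le hD hw)

/-- **`hlegs` FROM THE PAIRING, BY NAME through `LegsShellBound.hlegs_of_germWindow`**: in the currency `Φ w = a·(w_μ·w_ν·K w)`, a global septic bound
`|a·K w − T w| ≤ D/(‖w‖∞+2)⁷` gives `|psum Φ R₀ − Σ_{w ∈ annulus 4 0 R₀} w_μ·w_ν·T w| ≤ 160·D` for EVERY window radius `R₀` — the `hlegs` binder shape of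
`RepAssembly.hrep_of_basePoint_nUniform` with `U₁ = 160·D`. [folklore] -/
theorem hlegs_of_pairing {Φ : Pt → ℝ} (hΦ : ∀ w, Φ w = a * (toReal w μ * toReal w ν * Kk w)) (hD : 0 ≤ D)
    (h : ∀ w : Pt, |a * Kk w - T w| ≤ D / ((supNorm w : ℝ) + 2) ^ 7) (R₀ : ℕ) :
    |psum Φ R₀ - ∑ w ∈ annulus 4 0 R₀, toReal w μ * toReal w ν * T w| ≤ 160 * D :=
  LegsShellBound.hlegs_of_germWindow hΦ hD (germWindow_of_pairing hD h R₀)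

end Window

end Summit.QuantumFields.BalabanUV.Beta.FP.LegPairingRemainder

end
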